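import Literature.NumberTheory.GelbartRogawski1991.LocalUnitaryBlockRestriction     -- ★ `BlockSum.inlLoc`, `inlLoc_apply`
import Literature.NumberTheory.Automorphic.UnitaryGroupDualPairLocalLine             -- ★ `localLineInl`, `coe_localLineGL_apply`
import HarnessLib

/-!
# `(g ⊕ 1) ⊗ 1_W = (g ⊗ 1_W) ⊕ 1`: the dual-pair line embedding commutes with the block embeddings

Kudla, *Seesaw dual reductive pairs*, Progr. Math. 46 (1984), §1: for an orthogonal sum `V = V₁ ⊕ V₂` of hermitian spaces and a
hermitian LINE `W`, the first member `U(V) → U(V ⊗ W)`, `k ↦ k ⊗ 1_W` of the pair `(U(V), U(W))` carries the block inclusion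
`U(V₁) ↪ U(V)`, `g ↦ g ⊕ 1`, to the block inclusion `U(V₁ ⊗ W) ↪ U(V ⊗ W)` of the see-saw pair — on matrices, in the standard
enumerations `Fin N × Fin 1 ≃ Fin N` (`Equiv.prodUnique`), `(g ⊕ 1) ⊗ 1 = (g ⊗ 1) ⊕ 1` because `M ⊗ 1₁ = M`.  THEOREMS ONLY (no `def`,
no instance, no notation, no named fact, no `sorry`).

* `reindex_prodUnique_kronecker_one` — `reindex e_std e_std (M ⊗ₖ 1₁) = M`.
* `localLineInl_inlLoc` — ★ `localLineInl … e_std … (BlockSum.inlLoc … g₁) = BlockSum.inlLoc … (localLineInl … e_std′ … g₁)` in the tree's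
  factor-form groups `localPi` (the two form bookkeepings `hJ₁ hJ` (V-side) and `hJ₁′ hJ′` (𝕎-side) are free hypotheses).

USE (crux H413, programme P2, N3 (a)-road, (C5a)): the letter's `ch = localLineInl e₁ ∘ localPiEquiv⁻¹ ∘ cmDatumLocalCongr T₀` sends the torus
`d(1, β, 1)` to `BlockSum.inlLocal … τ₁` in `U(diag dV′)` (★ `F0P2oBlockAdaptedCongruence.exists_blockAdaptedCongr` (i), ★ `localPiEquiv_symm_eq_inlLoc`);
this file moves it to `BlockSum.inlLoc` in `U((T₁ ⊕ᶠ T₂) ⊗ L)`, where the local see-saw ★ `DoubledBlock.toRep_localSplittingCMWith_inlLoc_boxSB` reads it.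

## References
* [Kudla1984] S. Kudla, *Seesaw dual reductive pairs*, Progr. Math. 46 (1984): §1.
* [GelbartRogawski1991] S. Gelbart, J. Rogawski, Invent. Math. 105 (1991): §3.2 p. 457.
-/

set_option autoImplicit false

noncomputable section

open scoped Matrix Kronecker
open NumberField IsDedekindDomain

namespace Literature.NumberTheory.GelbartRogawski1991.UnitaryDualPair.LocalSplitting.BlockSum

open Literature.NumberTheory.Automorphic Literature.NumberTheory.Automorphic.UnitaryGroup

/-- **`M ⊗ 1₁ = M` in the standard enumeration `Fin N × Fin 1 ≃ Fin N`.** [cite: Kudla1984, §1] -/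
theorem reindex_prodUnique_kronecker_one {R : Type*} [CommRing R] {N : ℕ} (M : Matrix (Fin N) (Fin N) R) :
    Matrix.reindex (Equiv.prodUnique (Fin N) (Fin 1)) (Equiv.prodUnique (Fin N) (Fin 1)) (M ⊗ₖ (1 : Matrix (Fin 1) (Fin 1) R)) = M := by
  ext i j
  rw [Matrix.reindex_apply, Matrix.submatrix_apply, Equiv.prodUnique_symm_apply, Equiv.prodUnique_symm_apply,
    Matrix.kroneckerMap_apply, Matrix.one_apply_eq, mul_one]

variable (F : Type) [Field F] [NumberField F] (E : Type) [Field E] [NumberField E] [Algebra F E] (c : E ≃ₐ[F] E)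
  (v : HeightOneSpectrum (𝓞 F)) (n₁ n₂ : ℕ)
  {T₁ : Matrix (Fin n₁) (Fin n₁) F} {T₂ : Matrix (Fin n₂) (Fin n₂) F}
  {T₁' : Matrix (Fin n₁) (Fin n₁) F} {T₂' : Matrix (Fin n₂) (Fin n₂) F}
  {JV₁ : Matrix (Fin n₁) (Fin n₁) E} (hJ₁ : JV₁ = T₁.map (algebraMap F E))
  {JV : Matrix (Fin (n₁ + n₂)) (Fin (n₁ + n₂)) E} (hJ : JV = (UnitaryGroup.finSum n₁ n₂ T₁ T₂).map (algebraMap F E))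
  (JW : Matrix (Fin 1) (Fin 1) E)
  (hJ₁' : Matrix.reindex (Equiv.prodUnique (Fin n₁) (Fin 1)) (Equiv.prodUnique (Fin n₁) (Fin 1)) (JV₁ ⊗ₖ JW) = T₁'.map (algebraMap F E))
  (hJ' : Matrix.reindex (Equiv.prodUnique (Fin (n₁ + n₂)) (Fin 1)) (Equiv.prodUnique (Fin (n₁ + n₂)) (Fin 1)) (JV ⊗ₖ JW) =
    (UnitaryGroup.finSum n₁ n₂ T₁' T₂').map (algebraMap F E))

/-- **`(g ⊕ 1) ⊗ 1_W = (g ⊗ 1_W) ⊕ 1`**: the line embedding `localLineInl` (first member of the dual pair `(U(V), U(W))`, `W` a line, standard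
enumeration) carries the block inclusion `BlockSum.inlLoc` of `U(V₁) ↪ U(V₁ ⊕ V₂)` to the block inclusion of `U(V₁ ⊗ W) ↪ U((V₁ ⊕ V₂) ⊗ W)` —
at every place `w ∣ v` both sides are the matrix `reindex (g₁,w ⊕ 1)` (★ `inlLoc_apply`, ★ `coe_localLineGL_apply`, `M ⊗ 1₁ = M`).
[cite: Kudla1984, §1] [cite: GelbartRogawski1991, §3.2 p. 457] -/
theorem localLineInl_inlLoc (g₁ : localPi E c n₁ JV₁ v) :
    localLineInl E c (n₁ + n₂) (Equiv.prodUnique (Fin (n₁ + n₂)) (Fin 1)) JV JW v (inlLoc F E c v n₁ n₂ hJ₁ hJ g₁) =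
      inlLoc F E c v n₁ n₂ hJ₁' hJ' (localLineInl E c n₁ (Equiv.prodUnique (Fin n₁) (Fin 1)) JV₁ JW v g₁) := by
  refine Subtype.ext (funext fun w => Units.ext ?_)
  rw [coe_localLineInl, coe_localLineGL_apply, inlLoc_apply, inlLoc_apply, UnitaryGroup.coe_reindexGL, UnitaryGroup.coe_blockDiagGL,
    UnitaryGroup.coe_reindexGL, UnitaryGroup.coe_blockDiagGL, coe_localLineInl, coe_localLineGL_apply, reindex_prodUnique_kronecker_one,
    reindex_prodUnique_kronecker_one]

end Literature.NumberTheory.GelbartRogawski1991.UnitaryDualPair.LocalSplitting.BlockSum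

end
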